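import Summits.QuantumFields.BalabanUV.Beta.FP.FineSplitJunctionLedger
import Summits.QuantumFields.BalabanUV.Beta.FP.PerfectAsymptoticsBFCov

/-!
# `BalabanUV.Beta.FP.FineSplitJunctionLedgerCov` — road «FP» for binder row D1, ROW KER-γ (α0), successor item «(α0)-KCOV-RESOCKET» (owner words CLAIMS
# 2026-08-21 l.28099, `KER-GAMMA-ALPHA2.md` v1.3 §9), sequel of `FP/PerfectAsymptoticsBFCov`: THE JUNCTION ENDs WITH THE REFLECTION LETTER (Kcov) ABSTRACT —
# `hasym_PiBF_vertex2OfK_of_fineSplit_of_cov`, `hasym_PiBF_vertex2OfK_of_near_far_of_cov`, `hasym_PiBF_vertex2OfK_of_far_nearPieces_of_cov` (the tree's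
# `FineSplitJunctionBiVertex` ∕ `…NearFar` ∕ `…Ledger` ENDs verbatim with `hreflP`∕`hreflG` replaced by `hKcov : AxisReflectionCovariant (flipK (PiBF wg wgh V W v w))`)

HONEST DEPENDENCY (page 1, mandatory): continuum YM on T⁴ ⇐ BetaPertH ∧ nine spine estimates (0/9 proved); BetaPertH ⇐ (D1) ∧ (D4) ∧
CAP+tail; G-an2-4 gates asym, D1 and NE2/3/4.  HONEST FRAMING (cell contract, verbatim): «discharging `BetaPertH` makes Bałaban's UV
stability UNCONDITIONAL — a real constructive-QFT result; it is NOT the continuum limit and NOT the Clay problem.»  THIS MODULE is [our object]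
COMPOSITION BY NAME: the three tree ENDs' bodies verbatim, calling the `_of_cov` parents instead of the contact-free ones; no `def`, no `def … : Prop`, nothing cited,
nothing of the manuscripts under audit asserted, 0 sorry; no existing file touched.  With `hKcov := PerfectAsymptoticsBFCov.axisReflectionCovariant_flipK_PiBF_contact₂ …`
these are the ENDs «re-socketed to R5′'s `hAr`» the owner asked for; with `hKcov := PerfectPolarizationReflection.axisReflectionCovariant_flipK_PiBF …` they are the tree's.
NOT (Kcov) for the literal, NOT hsplit, NOT (ASYMP), NOT D1; 0∕4 row-D1 binders; NOT BetaPertH, NOT continuum, NOT Clay.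

ABSOLUTE RULE (cell charter, verbatim): «No internally-minted statement may enter as a cited fact. Every hypothesis is either kernel-proved in this
package or a verbatim quotation of a PUBLISHED theorem with page reference. The manuscript(s) under audit are NOT citable for their own disputed
steps — they are the thing under adjudication; programme-internal (2001/route/tribunal) claims are never citable.»

CONTENT ([our object]): §1 `hasym_PiBF_vertex2OfK_of_fineSplit_of_cov`; §2 `hasym_PiBF_vertex2OfK_of_near_far_of_cov`; §3 `hasym_PiBF_vertex2OfK_of_far_nearPieces_of_cov`
(= the (LEDGER) skeleton's input END with (Kcov) displayed).
Provenance: D1 formalisation swarm LEAF PROVER 01, unit `b2b-balaban-beta-d1-formalise-leaf-01` gen 12, 2026-08-21, road FP row KER-γ (α0)-KCOV-RESOCKET.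
-/

noncomputable section

namespace Summit.QuantumFields.BalabanUV.Beta.FP.FineSplitJunctionLedgerCov

open Finset
open scoped BigOperators
open Literature.MathematicalPhysics.QuantumFieldTheory.Balaban1983to89
open Literature.MathematicalPhysics.QuantumFieldTheory.Balaban1983to89.Beta
open Literature.MathematicalPhysics.QuantumFieldTheory.Balaban1983to89.Beta.BubbleTransfer (c4)
open Literature.MathematicalPhysics.QuantumFieldTheory.Balaban1983to89.B12Normalization (stepBal)
open B12Sec2to5 (l1 l1_nonneg)
open PolarizationSign (AxisReflectionCovariant reflSign)
open ExpKernelCalculus (Site MKer Decays BiLoc comp shiftK tr tadpole bubble Zl Zl_nonneg)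
open OneStepResolventKernel (Fib LocStencil)
open OneStepKernelFamily (flipK colH)
open KernelWard (divV divW)
open KernelReflection (LegMap refK bondRefl)
open DyadicShell (Pt supNorm)
open LeadingCoefficient (kappaBal)
open AxialProjector (coProj)
open AxialDressing (axDressK decays_axDressK locStencil_coProj)
open SecondOrderResponse (vertex2OfK)
open Summit.QuantumFields.BalabanUV.Beta.GAN24.CombesThomas (sfStep smStep)
open Summit.QuantumFields.BalabanUV.Beta.D1BFx.MomentTransferPeriodicSum (dressedSumP)
open Summit.QuantumFields.BalabanUV.Beta.D1BFx.MomentTransferPeriodicEntry (EKer₂ dressedEntryP)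
open Summit.QuantumFields.BalabanUV.Beta.D1BFx.DressedTablesLeg (tadpoleTableA_apply bubbleTableA_apply)
open Summit.QuantumFields.BalabanUV.Beta.D1BFx.ReducedKernelSandwichLeg (fineHessA fineHessA_apply)
open Summit.QuantumFields.BalabanUV.Beta.D1BFx.ContactCount (abs_tadpole_le_of_entryBound abs_bubble_le_of_entryBound)
open Summit.QuantumFields.BalabanUV.Beta.FP.PerfectObjectsT (KPerf TPerfOf)
open Summit.QuantumFields.BalabanUV.Beta.FP.HorizontalBookkeeping (truncK truncK_apply)
open Summit.QuantumFields.BalabanUV.Beta.FP.WilsonCubicGerm (cubicGermOf)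
open Summit.QuantumFields.BalabanUV.Beta.FP.GhostCubicGerm (cubicGermOfSc)
open Summit.QuantumFields.BalabanUV.Beta.FP.BubbleGermValue (bfGerm ghostGerm)
open Summit.QuantumFields.BalabanUV.Beta.FP.PerfectPolarization (Pker G0ker PiBF)
open Summit.QuantumFields.BalabanUV.Beta.FP.PerfectPolarizationDecay (sextic_PiBF)
open Summit.QuantumFields.BalabanUV.Beta.FP.StepLawKHolds (exists_decays_KPerf_holds)
open Summit.QuantumFields.BalabanUV.Beta.FP.SymmetryK (shiftK_KPerf)
open Summit.QuantumFields.BalabanUV.Beta.FP.PerfectBubbleSandwich (entryHyps_perfCol_zero)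
open Summit.QuantumFields.BalabanUV.Beta.FP.PerfectFullSandwich (TPerfOf_vertex2OfK_eq_dressedEntryP)
open Summit.QuantumFields.BalabanUV.Beta.FP.RemainderLedger (rem_sum)
open Summit.QuantumFields.BalabanUV.Beta.FP.FineSplitJunction (dressedEntryP_split)
open Summit.QuantumFields.BalabanUV.Beta.FP.FineSplitJunctionFar (rem_far_perfCol)
open Summit.QuantumFields.BalabanUV.Beta.FP.FineSplitJunctionNearFar (exists_bound_fineHessA_perfect fineSplit_near_far)
open Summit.QuantumFields.BalabanUV.Beta.FP.FineSplitJunctionLedger (rem_dressedEntryP_sum)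
open Summit.QuantumFields.BalabanUV.Beta.FP.PerfectAsymptoticsBFCov (hasym_PiBF_of_fineSplit_of_cov)

variable {Lc : ℕ} [NeZero Lc]

/-! ## §1 The bi-vertex END with (Kcov) displayed -/

/-- [our object] VERBATIM `FineSplitJunctionBiVertex.hasym_PiBF_vertex2OfK_of_fineSplit` with `hreflP`∕`hreflG` REPLACED by `hKcov`. -/
theorem hasym_PiBF_vertex2OfK_of_fineSplit_of_cov (hLc : 2 ≤ Lc) (wg wgh : ℝ)
    {V : Fin 4 → Site 4 → MKer 4 (Fib 3)} {W : Fin 4 → Site 4 → Fin 4 → Site 4 → MKer 4 (Fib 3)}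
    {v : Fin 4 → Site 4 → MKer 4 Unit} {w : Fin 4 → Site 4 → Fin 4 → Site 4 → MKer 4 Unit} {Cv Cw Cx Cw' Cx' CwL CwL' cQ δ : ℝ} (hδ : 0 < δ)
    -- admissible-family letters, gluon sector
    (hV : ∀ (μ : Fin 4) (y : Site 4), BiLoc (V μ y) y y Cv δ) (hW : ∀ (μ : Fin 4) (y : Site 4) (ν : Fin 4) (y' : Site 4), BiLoc (W μ y ν y') y y' Cw δ)
    (hcovV : ∀ (μ : Fin 4) (y t : Site 4), V μ (y + t) = shiftK (-t) (V μ y))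
    (hcovW : ∀ (μ : Fin 4) (y : Site 4) (ν : Fin 4) (y' t : Site 4), W μ (y + t) ν (y' + t) = shiftK (-t) (W μ y ν y'))
    (X : Site 4 → MKer 4 (Fib 3)) (hX : ∀ y, BiLoc (X y) y y Cx δ)
    (hW1 : ∀ y, comp (comp Pker (divV V y)) Pker = comp Pker (X y) - comp (X y) Pker)
    (hW2 : ∀ y ν y', divW W y ν y' = comp (X y) (V ν y') - comp (V ν y') (X y))
    (hKcov : AxisReflectionCovariant (flipK (PiBF wg wgh V W v w)))
    (h0V : ∀ (lam α β : Fin 4), ∑' p : Pt × Pt, V lam 0 p.1 p.2 (Sum.inl α) (Sum.inl β) = 0)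
    (hgermV : cubicGermOf V = cQ • bfGerm)
    (hWloc : ∀ (μ ν : Fin 4) (z : Pt), BiLoc (W μ 0 ν z) 0 z (CwL * Real.exp (-δ * l1 z)) δ)
    -- admissible-family letters, ghost sector
    (hv : ∀ (μ : Fin 4) (y : Site 4), BiLoc (v μ y) y y Cv δ) (hw : ∀ (μ : Fin 4) (y : Site 4) (ν : Fin 4) (y' : Site 4), BiLoc (w μ y ν y') y y' Cw' δ)
    (hcovv : ∀ (μ : Fin 4) (y t : Site 4), v μ (y + t) = shiftK (-t) (v μ y))
    (hcovw : ∀ (μ : Fin 4) (y : Site 4) (ν : Fin 4) (y' t : Site 4), w μ (y + t) ν (y' + t) = shiftK (-t) (w μ y ν y'))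
    (Xg : Site 4 → MKer 4 Unit) (hXg : ∀ y, BiLoc (Xg y) y y Cx' δ)
    (hW1g : ∀ y, comp (comp G0ker (divV v y)) G0ker = comp G0ker (Xg y) - comp (Xg y) G0ker)
    (hW2g : ∀ y ν y', divW w y ν y' = comp (Xg y) (v ν y') - comp (v ν y') (Xg y))
    (h0v : ∀ lam : Fin 4, ∑' p : Pt × Pt, v lam 0 p.1 p.2 () () = 0)
    (hgermv : cubicGermOfSc v = ghostGerm)
    (hwloc : ∀ (μ ν : Fin 4) (z : Pt), BiLoc (w μ 0 ν z) 0 z (CwL' * Real.exp (-δ * l1 z)) δ)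
    -- the colour weights and the entry
    {N : ℝ} (hn : (40 * wg * (1 / 4 : ℝ) * (c4 * cQ) ^ 2 - wgh * (-(1 / 2 : ℝ)) * c4 ^ 2) / 3 = kappaBal N)
    {μ ν : Fin 4} (hμν : μ ≠ ν)
    -- the road's first-order stencils and bi-tables at every `m` (letters per `m`, constants free)
    {S : ℕ → Fin (3 + 1) → (Fin (3 + 1) → ℤ) → MKer (3 + 1) (Fib 3)}
    (hS : ∀ m : ℕ, 1 ≤ m → ∃ Cs δs : ℝ, 0 < δs ∧ LocStencil (S m) Cs δs ∧
      ∀ κ u t, S m κ (u + ((Lc ^ m : ℕ) : ℤ) • t) = shiftK (-(((Lc ^ m : ℕ) : ℤ) • t)) (S m κ u))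
    {Wf : ℕ → Fin (3 + 1) → (Fin (3 + 1) → ℤ) → Fin (3 + 1) → (Fin (3 + 1) → ℤ) → MKer (3 + 1) (Fib 3)}
    (hWf : ∀ m : ℕ, 1 ≤ m → ∃ C2 δ2 : ℝ, 0 < δ2 ∧ (∀ κ' u l' u', BiLoc (Wf m κ' u l' u') u u' C2 δ2) ∧
      ∀ κ' u l' u' t, Wf m κ' (u + ((Lc ^ m : ℕ) : ℤ) • t) l' (u' + ((Lc ^ m : ℕ) : ℤ) • t)
        = shiftK (-(((Lc ^ m : ℕ) : ℤ) • t)) (Wf m κ' u l' u'))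
    -- the FINE split of the full fine kernel against the transported `PiBF`, bounded pieces, and the piece ledger
    {ι : Type*} (I : Finset ι) {G : ι → ℕ → EKer₂ 4} {B : ι → ℝ}
    (hfine : ∀ m : ℕ, 1 ≤ m → ∀ (c e : Fin 4) (s s' : Pt),
      fineHessA (axDressK (Lc ^ m) (KPerf (d := 3) Lc (sfStep Lc) (smStep 3 Lc) m)) (coProj (Lc ^ m) (S m)) (Wf m) c e s s'
        - ((Lc ^ m : ℕ) : ℝ) ^ 8 * truncK (PiBF wg wgh V W v w) (Lc ^ m) c e (s' - s) = ∑ i ∈ I, G i m c e s s')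
    (hGb : ∀ i ∈ I, ∀ m : ℕ, 1 ≤ m → ∀ c e : Fin 4, ∃ A, ∀ s s', |G i m c e s s'| ≤ A)
    (hpieces : ∀ i ∈ I, ∀ m : ℕ, 1 ≤ m → ∀ S' : Finset Pt, ∑ u ∈ S', (supNorm u : ℝ) ^ 2 *
      |dressedEntryP (fun c a => colH (KPerf (d := 3) Lc (sfStep Lc) (smStep 3 Lc) m) (Lc ^ m) a 0 c) (G i m)
        (((Lc ^ m : ℕ) : ℤ) • (-u)) μ ν| ≤ B i) :
    ∃ U₀ : ℝ, 0 ≤ U₀ ∧ ∃ Cg : ℝ, ∀ m : ℕ, 1 ≤ m →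
      |B12Beta.secondMoment (TPerfOf (Lc ^ m) (KPerf (d := 3) Lc (sfStep Lc) (smStep 3 Lc) m) (S m)
          (vertex2OfK (KPerf (d := 3) Lc (sfStep Lc) (smStep 3 Lc) m) (Lc ^ m) (Wf m))) μ ν - (m : ℝ) * stepBal N Lc|
        ≤ (U₀ + ∑ i ∈ I, B i) + Cg := by
  -- the sandwich at every `m`, K-side letters from the tree
  have hsand : ∀ m : ℕ, 1 ≤ m → ∀ u : Pt,
      TPerfOf (Lc ^ m) (KPerf (d := 3) Lc (sfStep Lc) (smStep 3 Lc) m) (S m)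
          (vertex2OfK (KPerf (d := 3) Lc (sfStep Lc) (smStep 3 Lc) m) (Lc ^ m) (Wf m)) μ ν u
        = dressedEntryP (fun c a => colH (KPerf (d := 3) Lc (sfStep Lc) (smStep 3 Lc) m) (Lc ^ m) a 0 c)
          (fineHessA (axDressK (Lc ^ m) (KPerf (d := 3) Lc (sfStep Lc) (smStep 3 Lc) m)) (coProj (Lc ^ m) (S m)) (Wf m))
          (((Lc ^ m : ℕ) : ℤ) • (-u)) μ ν := by
    intro m hm u
    have hn1 : 1 ≤ Lc ^ m := Nat.one_le_pow _ _ (by omega)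
    obtain ⟨CK, δK, hδK, hK⟩ := exists_decays_KPerf_holds hLc hm
    obtain ⟨Cs, δs, hδs, hSm, hScov⟩ := hS m hm
    obtain ⟨C2, δ2, hδ2, hWm, hWcov⟩ := hWf m hm
    have h := TPerfOf_vertex2OfK_eq_dressedEntryP (n := Lc ^ m) hn1 hK hδK (fun t => shiftK_KPerf Lc (sfStep Lc) (smStep 3 Lc) m t)
      (entryHyps_perfCol_zero hLc hm).absW hSm hδs (by exact_mod_cast hScov) hWm hδ2 (by exact_mod_cast hWcov) μ ν u
    simpa using h
  exact hasym_PiBF_of_fineSplit_of_cov hLc wg wgh hδ hV hW hcovV hcovW X hX hW1 hW2 hKcov h0V hgermV hWloc hv hw hcovv hcovw Xg hXg hW1g hW2g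
    h0v hgermv hwloc hn hμν
    (T := fun m => TPerfOf (Lc ^ m) (KPerf (d := 3) Lc (sfStep Lc) (smStep 3 Lc) m) (S m)
      (vertex2OfK (KPerf (d := 3) Lc (sfStep Lc) (smStep 3 Lc) m) (Lc ^ m) (Wf m)))
    (F := fun m => fineHessA (axDressK (Lc ^ m) (KPerf (d := 3) Lc (sfStep Lc) (smStep 3 Lc) m)) (coProj (Lc ^ m) (S m)) (Wf m))
    I hsand hfine hGb hpieces

/-! ## §2 The near–far END with (Kcov) displayed -/

/-- [our object] VERBATIM `FineSplitJunctionNearFar.hasym_PiBF_vertex2OfK_of_near_far` with `hreflP`∕`hreflG` REPLACED by `hKcov`. -/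
theorem hasym_PiBF_vertex2OfK_of_near_far_of_cov (hLc : 2 ≤ Lc) (wg wgh : ℝ)
    {V : Fin 4 → Site 4 → MKer 4 (Fib 3)} {W : Fin 4 → Site 4 → Fin 4 → Site 4 → MKer 4 (Fib 3)}
    {v : Fin 4 → Site 4 → MKer 4 Unit} {w : Fin 4 → Site 4 → Fin 4 → Site 4 → MKer 4 Unit} {Cv Cw Cx Cw' Cx' CwL CwL' cQ δ : ℝ} (hδ : 0 < δ)
    -- admissible-family letters, gluon sector
    (hV : ∀ (μ : Fin 4) (y : Site 4), BiLoc (V μ y) y y Cv δ) (hW : ∀ (μ : Fin 4) (y : Site 4) (ν : Fin 4) (y' : Site 4), BiLoc (W μ y ν y') y y' Cw δ)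
    (hcovV : ∀ (μ : Fin 4) (y t : Site 4), V μ (y + t) = shiftK (-t) (V μ y))
    (hcovW : ∀ (μ : Fin 4) (y : Site 4) (ν : Fin 4) (y' t : Site 4), W μ (y + t) ν (y' + t) = shiftK (-t) (W μ y ν y'))
    (X : Site 4 → MKer 4 (Fib 3)) (hX : ∀ y, BiLoc (X y) y y Cx δ)
    (hW1 : ∀ y, comp (comp Pker (divV V y)) Pker = comp Pker (X y) - comp (X y) Pker)
    (hW2 : ∀ y ν y', divW W y ν y' = comp (X y) (V ν y') - comp (V ν y') (X y))
    (hKcov : AxisReflectionCovariant (flipK (PiBF wg wgh V W v w)))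
    (h0V : ∀ (lam α β : Fin 4), ∑' p : Pt × Pt, V lam 0 p.1 p.2 (Sum.inl α) (Sum.inl β) = 0)
    (hgermV : cubicGermOf V = cQ • bfGerm)
    (hWloc : ∀ (μ ν : Fin 4) (z : Pt), BiLoc (W μ 0 ν z) 0 z (CwL * Real.exp (-δ * l1 z)) δ)
    -- admissible-family letters, ghost sector
    (hv : ∀ (μ : Fin 4) (y : Site 4), BiLoc (v μ y) y y Cv δ) (hw : ∀ (μ : Fin 4) (y : Site 4) (ν : Fin 4) (y' : Site 4), BiLoc (w μ y ν y') y y' Cw' δ)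
    (hcovv : ∀ (μ : Fin 4) (y t : Site 4), v μ (y + t) = shiftK (-t) (v μ y))
    (hcovw : ∀ (μ : Fin 4) (y : Site 4) (ν : Fin 4) (y' t : Site 4), w μ (y + t) ν (y' + t) = shiftK (-t) (w μ y ν y'))
    (Xg : Site 4 → MKer 4 Unit) (hXg : ∀ y, BiLoc (Xg y) y y Cx' δ)
    (hW1g : ∀ y, comp (comp G0ker (divV v y)) G0ker = comp G0ker (Xg y) - comp (Xg y) G0ker)
    (hW2g : ∀ y ν y', divW w y ν y' = comp (Xg y) (v ν y') - comp (v ν y') (Xg y))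
    (h0v : ∀ lam : Fin 4, ∑' p : Pt × Pt, v lam 0 p.1 p.2 () () = 0)
    (hgermv : cubicGermOfSc v = ghostGerm)
    (hwloc : ∀ (μ ν : Fin 4) (z : Pt), BiLoc (w μ 0 ν z) 0 z (CwL' * Real.exp (-δ * l1 z)) δ)
    -- the colour weights and the entry
    {N : ℝ} (hn : (40 * wg * (1 / 4 : ℝ) * (c4 * cQ) ^ 2 - wgh * (-(1 / 2 : ℝ)) * c4 ^ 2) / 3 = kappaBal N)
    {μ ν : Fin 4} (hμν : μ ≠ ν)
    -- the road's first-order stencils and bi-tables at every `m` (letters per `m`, constants free)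
    {S : ℕ → Fin (3 + 1) → (Fin (3 + 1) → ℤ) → MKer (3 + 1) (Fib 3)}
    (hS : ∀ m : ℕ, 1 ≤ m → ∃ Cs δs : ℝ, 0 < δs ∧ LocStencil (S m) Cs δs ∧
      ∀ κ u t, S m κ (u + ((Lc ^ m : ℕ) : ℤ) • t) = shiftK (-(((Lc ^ m : ℕ) : ℤ) • t)) (S m κ u))
    {Wf : ℕ → Fin (3 + 1) → (Fin (3 + 1) → ℤ) → Fin (3 + 1) → (Fin (3 + 1) → ℤ) → MKer (3 + 1) (Fib 3)}
    (hWf : ∀ m : ℕ, 1 ≤ m → ∃ C2 δ2 : ℝ, 0 < δ2 ∧ (∀ κ' u l' u', BiLoc (Wf m κ' u l' u') u u' C2 δ2) ∧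
      ∀ κ' u l' u' t, Wf m κ' (u + ((Lc ^ m : ℕ) : ℤ) • t) l' (u' + ((Lc ^ m : ℕ) : ℤ) • t)
        = shiftK (-(((Lc ^ m : ℕ) : ℤ) • t)) (Wf m κ' u l' u'))
    -- the FAR LETTER of the full fine kernel (m-free shape) and the NEAR LEDGER (one number)
    {CF a : ℝ} (hCF : 0 ≤ CF) (ha : 0 < a)
    (hfar : ∀ m : ℕ, 1 ≤ m → ∀ (c e : Fin 4) (s s' : Pt), Lc ^ m < supNorm (s' - s) →
      |fineHessA (axDressK (Lc ^ m) (KPerf (d := 3) Lc (sfStep Lc) (smStep 3 Lc) m)) (coProj (Lc ^ m) (S m)) (Wf m) c e s s'|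
        ≤ ((Lc ^ m : ℕ) : ℝ) ^ 8 * (CF / (supNorm (s' - s) : ℝ) ^ 6 * Real.exp (-(a / ((Lc ^ m : ℕ) : ℝ)) * (supNorm (s' - s) : ℝ))))
    {Bnear : ℝ}
    (hnear : ∀ m : ℕ, 1 ≤ m → ∀ S' : Finset Pt, ∑ u ∈ S', (supNorm u : ℝ) ^ 2 *
      |dressedEntryP (fun c a' => colH (KPerf (d := 3) Lc (sfStep Lc) (smStep 3 Lc) m) (Lc ^ m) a' 0 c)
        (fun c e s s' => if supNorm (s' - s) ≤ Lc ^ m then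
          fineHessA (axDressK (Lc ^ m) (KPerf (d := 3) Lc (sfStep Lc) (smStep 3 Lc) m)) (coProj (Lc ^ m) (S m)) (Wf m) c e s s'
            - ((Lc ^ m : ℕ) : ℝ) ^ 8 * PiBF wg wgh V W v w c e (s' - s) else 0)
        (((Lc ^ m : ℕ) : ℤ) • (-u)) μ ν| ≤ Bnear) :
    ∃ U : ℝ, 0 ≤ U ∧ ∃ Cg : ℝ, ∀ m : ℕ, 1 ≤ m →
      |B12Beta.secondMoment (TPerfOf (Lc ^ m) (KPerf (d := 3) Lc (sfStep Lc) (smStep 3 Lc) m) (S m)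
          (vertex2OfK (KPerf (d := 3) Lc (sfStep Lc) (smStep 3 Lc) m) (Lc ^ m) (Wf m))) μ ν - (m : ℝ) * stepBal N Lc|
        ≤ (U + Bnear) + Cg := by
  -- abbreviations (terms, not definitions)
  set K : ℕ → MKer (3 + 1) (Fib 3) := fun m => KPerf (d := 3) Lc (sfStep Lc) (smStep 3 Lc) m with hKdef
  set F : ℕ → EKer₂ 4 := fun m => fineHessA (axDressK (Lc ^ m) (K m)) (coProj (Lc ^ m) (S m)) (Wf m) with hFdef
  set G : Bool → ℕ → EKer₂ 4 := fun i m c e s s' =>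
    cond i (if Lc ^ m < supNorm (s' - s) then F m c e s s' else 0)
      (if supNorm (s' - s) ≤ Lc ^ m then F m c e s s' - ((Lc ^ m : ℕ) : ℝ) ^ 8 * PiBF wg wgh V W v w c e (s' - s) else 0) with hGdef
  -- (K6): a bound of `PiBF`
  have hLoc : LocStencil V Cv δ := fun κ u => hV κ u
  have hcovV0 : ∀ (lam : Fin 4) (u : Site 4), V lam u = shiftK (-u) (V lam 0) := fun lam u => by
    have h := hcovV lam 0 u; rwa [zero_add] at h
  have hcovv0 : ∀ (lam : Fin 4) (u : Site 4), v lam u = shiftK (-u) (v lam 0) := fun lam u => by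
    have h := hcovv lam 0 u; rwa [zero_add] at h
  obtain ⟨CP, hCP0, hKP⟩ := sextic_PiBF (wg := wg) (wgh := wgh) (cQ := cQ) hδ hLoc hcovV0 h0V hgermV hWloc hv hcovv0 h0v hgermv hwloc
  have hPb : ∀ (c e : Fin 4) (t : Pt), |PiBF wg wgh V W v w c e t| ≤ CP := fun c e t =>
    (hKP c e t).trans (div_le_self hCP0 (one_le_pow₀ (by
      have : (0 : ℝ) ≤ (supNorm t : ℝ) := Nat.cast_nonneg _
      linarith)))
  -- the far entry of the ledger, m-free
  obtain ⟨Bfar, hBfar0, hBfar⟩ := rem_far_perfCol (Lc := Lc) hLc (G := G true) (μ := μ) (ν := ν) hCF ha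
    (fun m hm c e s s' hfs => by
      show |(if Lc ^ m < supNorm (s' - s) then F m c e s s' else 0)| ≤ _
      rw [if_pos hfs]; exact hfar m hm c e s s' hfs)
    (fun m hm c e s s' hns => by
      show (if Lc ^ m < supNorm (s' - s) then F m c e s s' else 0) = 0
      rw [if_neg (not_lt.mpr hns)])
  -- the composition
  obtain ⟨U₀, hU₀, Cg, hmain⟩ := hasym_PiBF_vertex2OfK_of_fineSplit_of_cov hLc wg wgh hδ hV hW hcovV hcovW X hX hW1 hW2 hKcov h0V hgermV hWloc
    hv hw hcovv hcovw Xg hXg hW1g hW2g h0v hgermv hwloc hn hμν hS hWf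
    (Finset.univ : Finset Bool) (G := G) (B := fun i => cond i Bfar Bnear)
    (fun m hm c e s s' => by
      have h := fineSplit_near_far (F m) (PiBF wg wgh V W v w) (((Lc ^ m : ℕ) : ℝ) ^ 8) (Lc ^ m) c e s s'
      simpa only [hGdef] using h)
    (fun i _ m hm c e => by
      obtain ⟨Cs, δs, hδs, hSm, -⟩ := hS m hm
      obtain ⟨C2, δ2, hδ2, hWm, -⟩ := hWf m hm
      obtain ⟨AF, hAF⟩ := exists_bound_fineHessA_perfect (Lc := Lc) hLc hm hSm hδs hWm hδ2
      have hAF0 : 0 ≤ AF := (abs_nonneg _).trans (hAF c e 0 0)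
      refine ⟨AF + ((Lc ^ m : ℕ) : ℝ) ^ 8 * CP, fun s s' => ?_⟩
      cases i with
      | true =>
        show |(if Lc ^ m < supNorm (s' - s) then F m c e s s' else 0)| ≤ _
        split_ifs
        · exact (hAF c e s s').trans (le_add_of_nonneg_right (by positivity))
        · rw [abs_zero]; positivity
      | false =>
        show |(if supNorm (s' - s) ≤ Lc ^ m then F m c e s s' - ((Lc ^ m : ℕ) : ℝ) ^ 8 * PiBF wg wgh V W v w c e (s' - s) else 0)| ≤ _
        split_ifs
        · refine (abs_sub _ _).trans (add_le_add (hAF c e s s') ?_)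
          rw [abs_mul, abs_pow, Nat.abs_cast]
          exact mul_le_mul_of_nonneg_left (hPb c e _) (by positivity)
        · rw [abs_zero]; positivity)
    (fun i _ m hm S' => by
      cases i with
      | true => exact hBfar m hm S'
      | false => exact hnear m hm S')
  refine ⟨U₀ + Bfar, add_nonneg hU₀ hBfar0, Cg, fun m hm => ?_⟩
  have h := hmain m hm
  rw [Fintype.sum_bool] at h
  simp only [cond_true, cond_false] at h
  linarith

/-! ## §3 The ledger END with (Kcov) displayed -/

/-- [our object] VERBATIM `FineSplitJunctionLedger.hasym_PiBF_vertex2OfK_of_far_nearPieces` with `hreflP`∕`hreflG` REPLACED by `hKcov` — the (LEDGER) skeleton's input END,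
agnostic to how the reflection letter is supplied. -/
theorem hasym_PiBF_vertex2OfK_of_far_nearPieces_of_cov (hLc : 2 ≤ Lc) (wg wgh : ℝ)
    {V : Fin 4 → Site 4 → MKer 4 (Fib 3)} {W : Fin 4 → Site 4 → Fin 4 → Site 4 → MKer 4 (Fib 3)}
    {v : Fin 4 → Site 4 → MKer 4 Unit} {w : Fin 4 → Site 4 → Fin 4 → Site 4 → MKer 4 Unit} {Cv Cw Cx Cw' Cx' CwL CwL' cQ δ : ℝ} (hδ : 0 < δ)
    -- admissible-family letters, gluon sector
    (hV : ∀ (μ : Fin 4) (y : Site 4), BiLoc (V μ y) y y Cv δ) (hW : ∀ (μ : Fin 4) (y : Site 4) (ν : Fin 4) (y' : Site 4), BiLoc (W μ y ν y') y y' Cw δ)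
    (hcovV : ∀ (μ : Fin 4) (y t : Site 4), V μ (y + t) = shiftK (-t) (V μ y))
    (hcovW : ∀ (μ : Fin 4) (y : Site 4) (ν : Fin 4) (y' t : Site 4), W μ (y + t) ν (y' + t) = shiftK (-t) (W μ y ν y'))
    (X : Site 4 → MKer 4 (Fib 3)) (hX : ∀ y, BiLoc (X y) y y Cx δ)
    (hW1 : ∀ y, comp (comp Pker (divV V y)) Pker = comp Pker (X y) - comp (X y) Pker)
    (hW2 : ∀ y ν y', divW W y ν y' = comp (X y) (V ν y') - comp (V ν y') (X y))
    (hKcov : AxisReflectionCovariant (flipK (PiBF wg wgh V W v w)))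
    (h0V : ∀ (lam α β : Fin 4), ∑' p : Pt × Pt, V lam 0 p.1 p.2 (Sum.inl α) (Sum.inl β) = 0)
    (hgermV : cubicGermOf V = cQ • bfGerm)
    (hWloc : ∀ (μ ν : Fin 4) (z : Pt), BiLoc (W μ 0 ν z) 0 z (CwL * Real.exp (-δ * l1 z)) δ)
    -- admissible-family letters, ghost sector
    (hv : ∀ (μ : Fin 4) (y : Site 4), BiLoc (v μ y) y y Cv δ) (hw : ∀ (μ : Fin 4) (y : Site 4) (ν : Fin 4) (y' : Site 4), BiLoc (w μ y ν y') y y' Cw' δ)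
    (hcovv : ∀ (μ : Fin 4) (y t : Site 4), v μ (y + t) = shiftK (-t) (v μ y))
    (hcovw : ∀ (μ : Fin 4) (y : Site 4) (ν : Fin 4) (y' t : Site 4), w μ (y + t) ν (y' + t) = shiftK (-t) (w μ y ν y'))
    (Xg : Site 4 → MKer 4 Unit) (hXg : ∀ y, BiLoc (Xg y) y y Cx' δ)
    (hW1g : ∀ y, comp (comp G0ker (divV v y)) G0ker = comp G0ker (Xg y) - comp (Xg y) G0ker)
    (hW2g : ∀ y ν y', divW w y ν y' = comp (Xg y) (v ν y') - comp (v ν y') (Xg y))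
    (h0v : ∀ lam : Fin 4, ∑' p : Pt × Pt, v lam 0 p.1 p.2 () () = 0)
    (hgermv : cubicGermOfSc v = ghostGerm)
    (hwloc : ∀ (μ ν : Fin 4) (z : Pt), BiLoc (w μ 0 ν z) 0 z (CwL' * Real.exp (-δ * l1 z)) δ)
    -- the colour weights and the entry
    {N : ℝ} (hn : (40 * wg * (1 / 4 : ℝ) * (c4 * cQ) ^ 2 - wgh * (-(1 / 2 : ℝ)) * c4 ^ 2) / 3 = kappaBal N)
    {μ ν : Fin 4} (hμν : μ ≠ ν)
    -- the road's first-order stencils and bi-tables at every `m` (letters per `m`, constants free)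
    {S : ℕ → Fin (3 + 1) → (Fin (3 + 1) → ℤ) → MKer (3 + 1) (Fib 3)}
    (hS : ∀ m : ℕ, 1 ≤ m → ∃ Cs δs : ℝ, 0 < δs ∧ LocStencil (S m) Cs δs ∧
      ∀ κ u t, S m κ (u + ((Lc ^ m : ℕ) : ℤ) • t) = shiftK (-(((Lc ^ m : ℕ) : ℤ) • t)) (S m κ u))
    {Wf : ℕ → Fin (3 + 1) → (Fin (3 + 1) → ℤ) → Fin (3 + 1) → (Fin (3 + 1) → ℤ) → MKer (3 + 1) (Fib 3)}
    (hWf : ∀ m : ℕ, 1 ≤ m → ∃ C2 δ2 : ℝ, 0 < δ2 ∧ (∀ κ' u l' u', BiLoc (Wf m κ' u l' u') u u' C2 δ2) ∧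
      ∀ κ' u l' u' t, Wf m κ' (u + ((Lc ^ m : ℕ) : ℤ) • t) l' (u' + ((Lc ^ m : ℕ) : ℤ) • t)
        = shiftK (-(((Lc ^ m : ℕ) : ℤ) • t)) (Wf m κ' u l' u'))
    -- the FAR LETTER of the full fine kernel (m-free shape) and the NEAR LEDGER (one number)
    {CF a : ℝ} (hCF : 0 ≤ CF) (ha : 0 < a)
    (hfar : ∀ m : ℕ, 1 ≤ m → ∀ (c e : Fin 4) (s s' : Pt), Lc ^ m < supNorm (s' - s) →
      |fineHessA (axDressK (Lc ^ m) (KPerf (d := 3) Lc (sfStep Lc) (smStep 3 Lc) m)) (coProj (Lc ^ m) (S m)) (Wf m) c e s s'|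
        ≤ ((Lc ^ m : ℕ) : ℝ) ^ 8 * (CF / (supNorm (s' - s) : ℝ) ^ 6 * Real.exp (-(a / ((Lc ^ m : ℕ) : ℝ)) * (supNorm (s' - s) : ℝ))))
    -- the FINITE NEAR LEDGER
    {ι : Type*} (J : Finset ι) {G : ι → ℕ → EKer₂ 4} {B : ι → ℝ}
    (hnearSplit : ∀ m : ℕ, 1 ≤ m → ∀ (c e : Fin 4) (s s' : Pt),
      (if supNorm (s' - s) ≤ Lc ^ m then
          fineHessA (axDressK (Lc ^ m) (KPerf (d := 3) Lc (sfStep Lc) (smStep 3 Lc) m)) (coProj (Lc ^ m) (S m)) (Wf m) c e s s'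
            - ((Lc ^ m : ℕ) : ℝ) ^ 8 * PiBF wg wgh V W v w c e (s' - s) else 0) = ∑ j ∈ J, G j m c e s s')
    (hGb : ∀ j ∈ J, ∀ m : ℕ, 1 ≤ m → ∀ c e : Fin 4, ∃ A, ∀ s s', |G j m c e s s'| ≤ A)
    (hledger : ∀ j ∈ J, ∀ m : ℕ, 1 ≤ m → ∀ S' : Finset Pt, ∑ u ∈ S', (supNorm u : ℝ) ^ 2 *
      |dressedEntryP (fun c a' => colH (KPerf (d := 3) Lc (sfStep Lc) (smStep 3 Lc) m) (Lc ^ m) a' 0 c) (G j m)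
        (((Lc ^ m : ℕ) : ℤ) • (-u)) μ ν| ≤ B j) :
    ∃ U : ℝ, 0 ≤ U ∧ ∃ Cg : ℝ, ∀ m : ℕ, 1 ≤ m →
      |B12Beta.secondMoment (TPerfOf (Lc ^ m) (KPerf (d := 3) Lc (sfStep Lc) (smStep 3 Lc) m) (S m)
          (vertex2OfK (KPerf (d := 3) Lc (sfStep Lc) (smStep 3 Lc) m) (Lc ^ m) (Wf m))) μ ν - (m : ℝ) * stepBal N Lc|
        ≤ (U + ∑ j ∈ J, B j) + Cg := by
  -- the column letter at the perfect resolvent (absolute summability of the END columns)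
  have hcol : ∀ m, 1 ≤ m → ∀ κ l : Fin 4, Summable fun u => |TransportInfinityM.colOf (KPerf (d := 3) Lc (sfStep Lc) (smStep 3 Lc) m) κ l u| :=
    fun m hm κ l => (DecimatedMomentSummable.summable_of_absMoment₂ ((PerfectBubbleSandwich.entryHyps_perfCol_zero hLc hm).absW κ l)).abs
  have hcolH : ∀ m, 1 ≤ m → ∀ κ l : Fin 4,
      Summable fun u => |(fun c a' => colH (KPerf (d := 3) Lc (sfStep Lc) (smStep 3 Lc) m) (Lc ^ m) a' 0 c) κ l u| :=
    fun m hm κ l => FineSplitJunction.summable_abs_colH_of_colOf (hcol m hm) (Lc ^ m) κ l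
  -- the near number is the sum of the ledger
  have hnear : ∀ m : ℕ, 1 ≤ m → ∀ S' : Finset Pt, ∑ u ∈ S', (supNorm u : ℝ) ^ 2 *
      |dressedEntryP (fun c a' => colH (KPerf (d := 3) Lc (sfStep Lc) (smStep 3 Lc) m) (Lc ^ m) a' 0 c)
        (fun c e s s' => if supNorm (s' - s) ≤ Lc ^ m then
          fineHessA (axDressK (Lc ^ m) (KPerf (d := 3) Lc (sfStep Lc) (smStep 3 Lc) m)) (coProj (Lc ^ m) (S m)) (Wf m) c e s s'
            - ((Lc ^ m : ℕ) : ℝ) ^ 8 * PiBF wg wgh V W v w c e (s' - s) else 0)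
        (((Lc ^ m : ℕ) : ℤ) • (-u)) μ ν| ≤ ∑ j ∈ J, B j := fun m hm =>
    rem_dressedEntryP_sum J (w := fun m => fun c a' => colH (KPerf (d := 3) Lc (sfStep Lc) (smStep 3 Lc) m) (Lc ^ m) a' 0 c)
      (Nb := fun m => Lc ^ m) (m := m)
      (F := fun m c e s s' => if supNorm (s' - s) ≤ Lc ^ m then
          fineHessA (axDressK (Lc ^ m) (KPerf (d := 3) Lc (sfStep Lc) (smStep 3 Lc) m)) (coProj (Lc ^ m) (S m)) (Wf m) c e s s'
            - ((Lc ^ m : ℕ) : ℝ) ^ 8 * PiBF wg wgh V W v w c e (s' - s) else 0)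
      (hcolH m hm) (hnearSplit m hm) (fun j hj c e => hGb j hj m hm c e) (fun j hj S' => hledger j hj m hm S')
  exact hasym_PiBF_vertex2OfK_of_near_far_of_cov hLc wg wgh hδ hV hW hcovV hcovW X hX hW1 hW2 hKcov h0V hgermV hWloc hv hw hcovv hcovw Xg hXg hW1g hW2g
    h0v hgermv hwloc hn hμν hS hWf hCF ha hfar hnear

end Summit.QuantumFields.BalabanUV.Beta.FP.FineSplitJunctionLedgerCov

end
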